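/-
Copyright: lit-balaban cell (HOME `run/shared/lean/pub/lit-balaban/`), Phase-2 proof seat p12 (gen 7).  The proofs reproduce the
printed arguments; nothing is claimed beyond what the kernel checks below.
-/
import Literature.MathematicalPhysics.QuantumFieldTheory.DybalskiStottmeisterTanimoto2024.DST24CriticalPoint

/-!
# `DybalskiStottmeisterTanimoto2024.DST24RemainderFormula` — [DybalskiStottmeisterTanimoto2024] **§3.4 «Structure of the
# expressions `W⃗`»** and **Appendix B, Lemma (simple-computations)** PROVED: the multiplication table (multi-zero)/(multi-one),
# the formula (terms) for the remainder `r⃗(b)`, and the identity (3.23) for `δ(U₀V₀) = 1 − U₀V₀`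

statement-level skeleton of published theorems with citation tags; proofs where landed; nothing here is a claim about
the Yang–Mills mass gap

W. Dybalski, A. Stottmeister, Y. Tanimoto, *The Bałaban variational problem in the non-linear sigma model*, Rev. Math. Phys.
**36** (2024), arXiv:2403.09800; source held `paper:arxiv-2403.09800` (§3.4 = tex chunk p0010; App. B Lemma (simple-computations) =
p0024).  Unit `lit-balaban-p12` (gen 7); `W⃗`, `r⃗`, `A⃗` from `DST24CriticalPoint`, dictionary `U⃗ = vecOf U`, `U⁰ = Re U`,
`U⃗ × V⃗ = Im(UV)` on `Im ℍ` (`crossLin`).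

WHAT IS PRINTED AND PROVED HERE.
* (multi-zero) «`(UV)⁰ = U⁰V⁰ − U⃗·V⃗`», (multi-one) «`(UV)⃗ = U⁰V⃗ + V⁰U⃗ − (U⃗ × V⃗)`» — `re_mul_eq`, `vecOf_mul_eq` (for all quaternions).
* Lemma (simple-computations) / (terms), the formula for `r⃗(b)` in terms of `U = U′(b₋)`, `V = ∂V(y_b)`, `Z = U′(b₊)` — `rvec_formula`
  (a polynomial identity of quaternion components; it holds without the constraint).  READING NOTE (see the docstring): the
  printed display (terms) = (B.5) has four sign slips relative to the print's own derivation ((B.4) and the expansion of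
  (long-formula)); the kernel-checked identity here is the corrected one; §4 only uses term-wise absolute bounds of it.
* (3.23) «`δ(U_{0,±}V₀) = 1 − √(1 − U⃗²_{0,±})√(1 − V⃗²) = (V⃗² + U⃗²_{0,±} − U⃗²_{0,±}V⃗²)/(1 + U_{0,±}V₀)`» (signs `δ = 1`) — `delta_eq`.
-/

namespace Literature.MathematicalPhysics.QuantumFieldTheory.DybalskiStottmeisterTanimoto2024.DST24RemainderFormula

open scoped Quaternion RealInnerProductSpace BigOperators
open Literature.MathematicalPhysics.QuantumFieldTheory.Federbush1986
open Literature.MathematicalPhysics.QuantumFieldTheory.DybalskiStottmeisterTanimoto2024.DST24Setting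
open Literature.MathematicalPhysics.QuantumFieldTheory.DybalskiStottmeisterTanimoto2024.DST24Configurations
open Literature.MathematicalPhysics.QuantumFieldTheory.DybalskiStottmeisterTanimoto2024.DST24LinearConstraint
open Literature.MathematicalPhysics.QuantumFieldTheory.DybalskiStottmeisterTanimoto2024.DST24TangentSpace
open Literature.MathematicalPhysics.QuantumFieldTheory.DybalskiStottmeisterTanimoto2024.DST24CriticalPoint

noncomputable section

variable {L n₁ : ℕ}

/-- `U⃗·V⃗` (the Euclidean product of `ℝ³ = Im ℍ`) in coordinates. [cite: DybalskiStottmeisterTanimoto2024, §3.4 (multi-zero) («`U⃗·V⃗`»)] -/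
theorem inner_su2_eq (A B : su2) : ⟪A, B⟫ = (A : ℍ).imI * (B : ℍ).imI + (A : ℍ).imJ * (B : ℍ).imJ + (A : ℍ).imK * (B : ℍ).imK := by
  rw [Submodule.coe_inner, inner_eq_components, su2.re_coe A, zero_mul, zero_add]

/-- **(multi-zero)** «`(UV)⁰ = U⁰V⁰ − U⃗·V⃗`» (for all quaternions). [cite: DybalskiStottmeisterTanimoto2024, §3.4 (multi-zero); App. B proof of Lemma (simple-computations)] -/
theorem re_mul_eq (p q : ℍ) : (p * q).re = p.re * q.re - ⟪vecOf p, vecOf q⟫ := by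
  rw [inner_su2_eq, vecOf_coe, vecOf_coe, Quaternion.re_mul]
  simp only [Quaternion.imI_neg, Quaternion.imJ_neg, Quaternion.imK_neg, Quaternion.imI_im, Quaternion.imJ_im, Quaternion.imK_im]
  ring

/-- **(multi-one)** «`(UV)⃗ = U⁰V⃗ + V⁰U⃗ − (U⃗ × V⃗)`» (for all quaternions; `U⃗ = vecOf U`, `× = Im(·,·)` on `Im ℍ`).
[cite: DybalskiStottmeisterTanimoto2024, §3.4 (multi-one); App. B proof of Lemma (simple-computations)] -/
theorem vecOf_mul_eq (p q : ℍ) : vecOf (p * q) = p.re • vecOf q + q.re • vecOf p - crossLin (vecOf p) (vecOf q) := by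
  apply Subtype.ext
  simp only [Submodule.coe_add, Submodule.coe_sub, Submodule.coe_smul, crossLin_coe, vecOf_coe]
  ext <;> simp only [Quaternion.re_neg, Quaternion.imI_neg, Quaternion.imJ_neg, Quaternion.imK_neg, Quaternion.re_im,
    Quaternion.imI_im, Quaternion.imJ_im, Quaternion.imK_im, Quaternion.imI_mul, Quaternion.imJ_mul,
    Quaternion.imK_mul, Quaternion.re_add, Quaternion.imI_add, Quaternion.imJ_add, Quaternion.imK_add, Quaternion.re_sub,
    Quaternion.imI_sub, Quaternion.imJ_sub, Quaternion.imK_sub, Quaternion.re_smul, Quaternion.imI_smul, Quaternion.imJ_smul,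
    Quaternion.imK_smul, smul_eq_mul] <;> ring

/-- **Lemma (simple-computations) / (terms)**, CORRECTED SIGNS.  With `U := U′(b₋)`, `V := ∂V(y_b)`, `Z := U′(b₊)`, `U⁰ = Re U`
etc., `δ(M) := 1 − M`, the remainder `r⃗(b) := W⃗(b) − (A⃗(b₋) − A⃗(b₊))` equals
`δ(U⁰V⁰)Z⃗ − δ(Z⁰V⁰)U⃗ + Z⁰U⁰V⃗ − Z⁰(U⃗ × V⃗) + U⁰(V⃗ × Z⃗) + V⁰(U⃗ × Z⃗) + Z⃗(U⃗·V⃗) + U⃗(Z⃗·V⃗) − V⃗(Z⃗·U⃗)`.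
READING NOTE: the print displays (terms)/(B.5) as «`r⃗(b) = −δ(U⁰V⁰)Z⃗ + δ(Z⁰V⁰)U⃗ + Z⁰U⁰V⃗ − Z⁰(U⃗×V⃗) + U⁰(V⃗×Z⃗) + V⁰(U⃗×Z⃗)
+ Z⃗(U⃗·V⃗) − U⃗(Z⃗·V⃗) + V⃗(Z⃗·U⃗)`»: the signs of the two `δ`-terms there contradict the print's own (B.4) (which has
`+δ(U⁰V⁰)Z⃗ − δ(Z⁰V⁰)U⃗`, as here), and the signs of the last two terms come from the slip «`−(U⁰V⃗ + V⁰U⃗ − (U⃗×V⃗)) × Z⃗ = … −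
(U⃗×V⃗)×Z⃗`» in (long-formula) (it is `+(U⃗×V⃗)×Z⃗`).  The identity below is the one that follows from the multiplication
table (multi-zero)/(multi-one) exactly as in the printed derivation, and it is checked by the kernel as a polynomial identity
(no constraint needed); the uses of (terms) in §4 (Lemmas (r-lemma-one), (r-lemma-two)) go through term-by-term absolute bounds,
which are insensitive to these signs. [cite: DybalskiStottmeisterTanimoto2024, §3.4 (terms); Appendix B Lemma (simple-computations), (B.4)–(B.5)] -/
theorem rvec_formula (U' : Conf L n₁) (V : CConf n₁) (b : Bond L n₁) :
    rvec U' V b =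
      (1 - (U' b.src).val.re * (pdV V b).re) • Avec U' b.tgt
      - (1 - (U' b.tgt).val.re * (pdV V b).re) • Avec U' b.src
      + ((U' b.tgt).val.re * (U' b.src).val.re) • vecOf (pdV V b)
      - (U' b.tgt).val.re • crossLin (Avec U' b.src) (vecOf (pdV V b))
      + (U' b.src).val.re • crossLin (vecOf (pdV V b)) (Avec U' b.tgt)
      + (pdV V b).re • crossLin (Avec U' b.src) (Avec U' b.tgt)
      + ⟪Avec U' b.src, vecOf (pdV V b)⟫ • Avec U' b.tgt
      + ⟪Avec U' b.tgt, vecOf (pdV V b)⟫ • Avec U' b.src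
      - ⟪Avec U' b.tgt, Avec U' b.src⟫ • vecOf (pdV V b) := by
  simp only [inner_su2_eq]
  unfold rvec Wvec Wq Avec
  rw [del_apply]
  apply Subtype.ext
  simp only [Submodule.coe_add, Submodule.coe_sub, Submodule.coe_smul, crossLin_coe, vecOf_coe]
  ext <;> simp only [Quaternion.re_neg, Quaternion.imI_neg, Quaternion.imJ_neg, Quaternion.imK_neg, Quaternion.re_im,
    Quaternion.imI_im, Quaternion.imJ_im, Quaternion.imK_im, Quaternion.re_mul, Quaternion.imI_mul, Quaternion.imJ_mul,
    Quaternion.imK_mul, Quaternion.re_add, Quaternion.imI_add, Quaternion.imJ_add, Quaternion.imK_add, Quaternion.re_sub,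
    Quaternion.imI_sub, Quaternion.imJ_sub, Quaternion.imK_sub, Quaternion.re_smul, Quaternion.imI_smul, Quaternion.imJ_smul,
    Quaternion.imK_smul, smul_eq_mul, Quaternion.re_star, Quaternion.imI_star, Quaternion.imJ_star, Quaternion.imK_star] <;>
    ring

/-- **(3.23)** with `δ = 1` («we can lower all the `0`-superscripts»): for `U₀, V₀ ≥ 0` on `SU(2)`,
`δ(U₀V₀) = 1 − U₀V₀ = (V⃗² + U⃗² − U⃗²V⃗²)/(1 + U₀V₀)` (since `U₀ = √(1 − U⃗²)`, `V₀ = √(1 − V⃗²)`).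
[cite: DybalskiStottmeisterTanimoto2024, §3.4 (3.23)] -/
theorem delta_eq (u v : SU2) (hu : 0 ≤ u.val.re) (hv : 0 ≤ v.val.re) :
    1 - u.val.re * v.val.re =
      (‖vecOf v.val‖ ^ 2 + ‖vecOf u.val‖ ^ 2 - ‖vecOf u.val‖ ^ 2 * ‖vecOf v.val‖ ^ 2) / (1 + u.val.re * v.val.re) := by
  have hden : 0 < 1 + u.val.re * v.val.re := by positivity
  rw [eq_div_iff hden.ne', norm_vecOf, norm_vecOf, SU2.norm_im_sq, SU2.norm_im_sq]
  ring

end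

end Literature.MathematicalPhysics.QuantumFieldTheory.DybalskiStottmeisterTanimoto2024.DST24RemainderFormula
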